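import Literature.MathematicalPhysics.QuantumFieldTheory.Balaban1983to89.B14Components

/-!
# `Balaban1983to89.B14BoxFix` — the «smallest rectangular parallelepiped» replacement of small components
([III] pp. 251, 269) against the inductive condition (2.3) (p. 255): single pass vs. iteration to the fixpoint
(cell `GAPS.md` G-adv5-9, G-adv5-11 (i); C-B14s-12; `DIVERGENCE.md` D-pv02.17)

CITATION HEADER (lean-in-tree rule 2026-08-18).  Source: T. Bałaban, *Convergent renormalization expansions for
lattice gauge theories*, Commun. Math. Phys. **119**, 243–285 (1988) [Balaban1988Convergent] (cell paper B14 =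
[III]), pp. 251, 255, 269.  The three quotations below were read by the typist on the x2 page renders of the cell
folder `b2b-balaban-ref1/pages/1988-cmp119-convergent-renormalization/` (`…-p009`, `…-p013`, `…-p027`).  The paper
is a manuscript UNDER ADJUDICATION by the audit cell `pub-balaban`: NOTHING printed in it is asserted here.  Every
`theorem` below is elementary (boxes of integer points, reflexive–transitive closures, cardinalities of finite
sets), proved without `sorry` and without new axioms.  NEW sibling module of unit `b2b-balaban-pv02` (gen 3,
journal claim G-adv5-9-FIXPOINT-KERNEL), the kernel companion of the referee rows G-adv5-9 (`b2b-balaban-adv5`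
gen 5) and G-adv5-11 (gen 7), addressed by them to the pv02 lineage.  It imports `…B14Components` (pv02: `Touching`,
`TConn`, `tComp` — the touching reading of «component», cell GAPS C-adv5-15) and modifies nothing.

THE PRINTED TEXT (verbatim).
* p. 251 [PDF 9], after (1.20): *"We make an additional small modification of the domain Λ₁. The complement Λ₁ᶜ
  is a union of connected components, and some of them may be relatively small. We distinguish components which
  are contained in cubes of sizes smaller than 100LMR₁, and we replace such components by the smallest rectangular
  parallelepipeds containing them. Such a rectangular parallelepiped is the smallest convex domain, which is a
  union of LMR₁-cubes, containing a given component. This change is insignificant from the point of view of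
  bounds, but it simplifies some geometric aspects of the large field problem, and the 𝐑-operation. This domain Λ₁
  is the final small field domain, and we will perform the conditional integration in the integral (1.15) with
  respect to the fluctuation field A restricted to Λ₁."*  [v1.1: sentence completed — referee row G-ref1-14 (a);
  render p009 re-read.]
* p. 255 [PDF 13]: *"Z_j = Λ_jᶜ. (2.3) These large field regions satisfy the following condition: if a component of
  Z_j is contained in a cube of the size 100MR_j (in the L^{−j}-lattice), then it is a rectangular
  parallelepiped."*
* p. 269 [PDF 27], after (3.20): *"In fact we modify the domain Λ_{k+1} in the same way as in Sect. 1; we consider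
  components of Λᶜ_{k+1}, and if a component is contained in a cube of the size 100LMR_{k+1}, then we replace it
  by the smallest rectangular parallelepiped containing it."*

THE MODEL (cell DIVERGENCE.md D-pv02.17).  Everything is stated on CUBE INDICES `c ∈ ℤ^d` (`Pt d` of
`…B14DomainGeom`; one index = one `LMR`-cube of the relevant lattice), with the TOUCHING reading of «component»
(`…B14Components.TConn` / `tComp`; cell GAPS C-adv5-15).  `ibox lo hi` is the rectangular parallelepiped of cubes
with index bounds `lo ≤ c ≤ hi`; `bbox K` the smallest one containing `K` (*"the smallest rectangular
parallelepiped containing"* it; `bbox_subset_ibox`, `bbox_isBox`); `FitsIn N K` says that `K` *"is contained in a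
cube of the size"* `N` cubes per side (printed: `100LMR` on the `LMR`-cube lattice, i.e. `N = 100`; the unit
conversion between p. 251 and (2.3) is the referee's, G-adv5-9, not re-derived here); `Cond23 N Z` is (2.3): every
component of `Z` that fits in an `N`-cube IS a box; `pass N Z` is ONE SIMULTANEOUS application of the printed
replacement to all small components of `Z` (the union of `Z` with the bounding boxes of its small components).

WHAT IS KERNEL-CHECKED.  (A) Boxes are touching-connected (`ibox_tconn`, by the clamped straight walk `approach`);
the bounding box of a finite non-empty set is a box (`bbox_isBox`) and is the least box containing it
(`bbox_subset_ibox`).  (B) AT A FIXPOINT, (2.3) HOLDS: `pass N Z = Z → Cond23 N Z` (`cond23_of_fixpoint`: a small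
component whose bounding box lies in `Z` equals that box, because the box is connected).  (C) THE ITERATION
TERMINATES: any inflationary operation `Φ` on subsets of a finite set `A` (`Z ⊆ Φ Z ⊆ A`) satisfies
`Φ (Φ^[#A] Z) = Φ^[#A] Z` (`iterate_fix`, by counting); `pass N` is inflationary inside any box `A ⊇ Z`
(`pass_inflationary`), so `(pass N)^[#A] Z` is a fixpoint containing `Z` and satisfies (2.3)
(`pass_iterate_fixpoint`, `cond23_iterate`) — the referee's REPAIR of G-adv5-9 («iterate the replacement until
stable …; terminates; (2.3) by construction»), as a theorem.  (D) A SINGLE PASS DOES NOT GIVE (2.3) (`d = 2`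
instance of the referee's example, G-adv5-9): `K1` = the one-layer touching-enlargement of the three cubes
`(0,0), (0,3), (3,0)` (an L: `[−1,1]×[−1,4] ∪ [−1,4]×[−1,1]`, `K1_eq_ienl`), `K2 = [5,7]²` (the enlargement of
`(6,6)`); they are the two components of `Z0 = K1 ∪ K2` (`tComp_Z0_of_mem_K1`, `tComp_Z0_of_mem_K2`), both small;
the single pass gives `pass N Z0 = [−1,4]² ∪ [5,7]² = Z1` (`pass_Z0`, `N ≥ 6`), whose cubes `(4,4)` and `(5,5)` touch
at a corner: `Z1` is ONE component (`tComp_Z1`), fits in a `9`-cube, and is NOT a box (`Z1_not_box`) — hence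
`¬ Cond23 N (pass N Z0)` for every `N ≥ 9`, in particular `N = 100` (`single_pass_fails`); a second pass adjoins
`bbox Z1 = [−1,7]²` (`pass_Z1_eq_bbox`), as the iteration of (C) prescribes.

WHAT IS *NOT* ASSERTED: whether the author means one pass or the stable result (the text says «replace such
components» once, at each step; the referee reads a single simultaneous pass, G-adv5-9 and G-adv5-11, and proposes the
fixpoint as the repair — recorded in DIVERGENCE.md D-pv02.17, not adjudicated); the wall-connectivity variant of
(D) (G-adv5-9 gives one; not typed); anything about *"insignificant from the point of view of bounds"* (G-adv5-9
last clause, G-adv5-11 (iii)); the realisation of `K1`, `K2` as an actual `Λ₁ᶜ` of (1.20) (they have the SHAPE of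
one-layer enlargements `R₁′~`, which is all the example needs at index level).  Value = kernel certificate for a
referee objection and its repair, NOT summit progress.  Companion rows: cell `GAPS.md` C-B14s-12; `DIVERGENCE.md`
D-pv02.17.
-/

namespace Literature.MathematicalPhysics.QuantumFieldTheory.Balaban1983to89.B14BoxFix

open Literature.MathematicalPhysics.QuantumFieldTheory.Balaban1983to89.B14DomainGeom
open Literature.MathematicalPhysics.QuantumFieldTheory.Balaban1983to89.B14Components

variable {d : ℕ}

/-! ## A. Boxes of cube indices and the bounding box -/

/-- The rectangular parallelepiped of cubes with index bounds `lo ≤ c ≤ hi` (coordinatewise).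
[cite: Balaban1988Convergent, p.251] -/
def ibox (lo hi : Pt d) : Set (Pt d) := {c | ∀ i, lo i ≤ c i ∧ c i ≤ hi i}

/-- `K` *"is a rectangular parallelepiped"* ((2.3)). [cite: Balaban1988Convergent, (2.3) p.255] -/
def IsBox (K : Set (Pt d)) : Prop := ∃ lo hi : Pt d, K = ibox lo hi

/-- `K` *"is contained in a cube of the size"* `N` (cubes per side). [cite: Balaban1988Convergent, (2.3) p.255] -/
def FitsIn (N : ℕ) (K : Set (Pt d)) : Prop := ∃ lo : Pt d, K ⊆ ibox lo (fun i => lo i + (N : ℤ) - 1)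

/-- The bounding box of `K`: the cubes lying, in every coordinate, between two cubes of `K` — *"the smallest
rectangular parallelepiped containing"* `K` (`subset_bbox`, `bbox_subset_ibox`, `bbox_isBox`).
[cite: Balaban1988Convergent, p.251] -/
def bbox (K : Set (Pt d)) : Set (Pt d) := {c | ∀ i, (∃ a ∈ K, a i ≤ c i) ∧ (∃ b ∈ K, c i ≤ b i)}

/-- [folklore] -/
theorem subset_bbox (K : Set (Pt d)) : K ⊆ bbox K := fun c hc _ => ⟨⟨c, hc, le_rfl⟩, ⟨c, hc, le_rfl⟩⟩

/-- The bounding box is contained in every box containing `K` (*"the smallest"*). [cite: Balaban1988Convergent, p.251] -/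
theorem bbox_subset_ibox {K : Set (Pt d)} {lo hi : Pt d} (h : K ⊆ ibox lo hi) : bbox K ⊆ ibox lo hi := by
  intro c hc i
  obtain ⟨⟨a, ha, hac⟩, ⟨b, hb, hcb⟩⟩ := hc i
  exact ⟨le_trans (h ha i).1 hac, le_trans hcb (h hb i).2⟩

/-- [folklore] -/
theorem bbox_mono {K K' : Set (Pt d)} (h : K ⊆ K') : bbox K ⊆ bbox K' := by
  intro c hc i
  obtain ⟨⟨a, ha, hac⟩, ⟨b, hb, hcb⟩⟩ := hc i
  exact ⟨⟨a, h ha, hac⟩, ⟨b, h hb, hcb⟩⟩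

/-- The bounding box of a box is itself. [folklore] -/
theorem bbox_ibox (lo hi : Pt d) : bbox (ibox lo hi) = ibox lo hi :=
  Set.Subset.antisymm (bbox_subset_ibox subset_rfl) (subset_bbox _)

/-- [folklore] -/
theorem FitsIn.bbox {N : ℕ} {K : Set (Pt d)} (h : FitsIn N K) : FitsIn N (bbox K) := by
  obtain ⟨lo, hlo⟩ := h
  exact ⟨lo, bbox_subset_ibox hlo⟩

/-- [folklore] -/
theorem FitsIn.mono {N N' : ℕ} (hN : N ≤ N') {K : Set (Pt d)} (h : FitsIn N K) : FitsIn N' K := by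
  obtain ⟨lo, hlo⟩ := h
  refine ⟨lo, fun c hc i => ⟨(hlo hc i).1, ?_⟩⟩
  have := (hlo hc i).2
  have hNN : (N : ℤ) ≤ N' := by exact_mod_cast hN
  simp only at this ⊢
  linarith

/-- A box is a product of integer intervals … [folklore] -/
theorem ibox_eq_pi (lo hi : Pt d) : ibox lo hi = Set.univ.pi (fun i => Set.Icc (lo i) (hi i)) := by
  ext c
  simp only [ibox, Set.mem_setOf_eq, Set.mem_univ_pi, Set.mem_Icc]

/-- … hence finite. [folklore] -/
theorem ibox_finite (lo hi : Pt d) : (ibox lo hi).Finite := by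
  rw [ibox_eq_pi]
  exact Set.Finite.pi (fun i => Set.finite_Icc _ _)

/-- A set that fits in a cube is finite. [folklore] -/
theorem FitsIn.finite {N : ℕ} {K : Set (Pt d)} (h : FitsIn N K) : K.Finite := by
  obtain ⟨lo, hlo⟩ := h
  exact (ibox_finite _ _).subset hlo

/-- The bounding box of a finite non-empty set of cubes is a box (coordinatewise minima and maxima are attained).
[cite: Balaban1988Convergent, p.251] -/
theorem bbox_isBox {K : Set (Pt d)} (hfin : K.Finite) (hne : K.Nonempty) : IsBox (bbox K) := by
  have hlo : ∀ i, ∃ a ∈ K, ∀ b ∈ K, a i ≤ b i := fun i => Set.exists_min_image K (fun c => c i) hfin hne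
  have hhi : ∀ i, ∃ a ∈ K, ∀ b ∈ K, b i ≤ a i := fun i => Set.exists_max_image K (fun c => c i) hfin hne
  choose amin hamin hmin using hlo
  choose amax hamax hmax using hhi
  refine ⟨fun i => amin i i, fun i => amax i i, ?_⟩
  ext c
  constructor
  · intro hc i
    obtain ⟨⟨a, ha, hac⟩, ⟨b, hb, hcb⟩⟩ := hc i
    exact ⟨le_trans (hmin i a ha) hac, le_trans hcb (hmax i b hb)⟩
  · intro hc i
    exact ⟨⟨amin i, hamin i, (hc i).1⟩, ⟨amax i, hamax i, (hc i).2⟩⟩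

/-! ## B. Boxes are touching-connected: the clamped straight walk -/

/-- Walk from `a` toward `b`, every coordinate moving by at most `n`. [folklore] -/
def approach (a b : Pt d) (n : ℕ) : Pt d := fun i => a i + max (-(n : ℤ)) (min (n : ℤ) (b i - a i))

/-- [folklore] -/
theorem approach_zero (a b : Pt d) : approach a b 0 = a := by
  funext i
  simp only [approach, Nat.cast_zero, neg_zero]
  rw [max_def, min_def]
  split_ifs <;> omega

/-- [folklore] -/
theorem approach_of_le (a b : Pt d) {n : ℕ} (h : ∀ i, |b i - a i| ≤ n) : approach a b n = b := by
  funext i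
  have hi := abs_le.mp (h i)
  simp only [approach]
  rw [max_def, min_def]
  split_ifs <;> omega

/-- Consecutive points of the walk touch. [folklore] -/
theorem approach_touching (a b : Pt d) (n : ℕ) : Touching (approach a b n) (approach a b (n + 1)) := by
  intro i
  rw [abs_le]
  simp only [approach, Nat.cast_succ]
  rw [max_def, max_def, min_def, min_def]
  constructor <;> (split_ifs <;> omega)

/-- The walk stays coordinatewise between `a` and `b`. [folklore] -/
theorem approach_between (a b : Pt d) (n : ℕ) (i : Fin d) :
    min (a i) (b i) ≤ approach a b n i ∧ approach a b n i ≤ max (a i) (b i) := by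
  simp only [approach]
  rw [max_def, max_def, min_def, min_def]
  constructor <;> (split_ifs <;> omega)

/-- Boxes are coordinatewise convex. [folklore] -/
theorem ibox_between {lo hi a b c : Pt d} (ha : a ∈ ibox lo hi) (hb : b ∈ ibox lo hi)
    (hc : ∀ i, min (a i) (b i) ≤ c i ∧ c i ≤ max (a i) (b i)) : c ∈ ibox lo hi := by
  intro i
  have h1 := ha i
  have h2 := hb i
  have h3 := hc i
  rw [min_def, max_def] at h3
  constructor <;> (split_ifs at h3 <;> omega)

/-- **A box is touching-connected**: any two of its cubes are joined by a chain of touching cubes of the box.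
[folklore] -/
theorem ibox_tconn {lo hi a b : Pt d} (ha : a ∈ ibox lo hi) (hb : b ∈ ibox lo hi) : TConn (ibox lo hi) a b := by
  have hmem : ∀ n, approach a b n ∈ ibox lo hi := fun n => ibox_between ha hb (approach_between a b n)
  have key : ∀ n : ℕ, TConn (ibox lo hi) a (approach a b n) := by
    intro n
    induction n with
    | zero => rw [approach_zero]; exact Relation.ReflTransGen.refl
    | succ n ih => exact Relation.ReflTransGen.tail ih ⟨hmem n, hmem (n + 1), approach_touching a b n⟩
  let N : ℕ := Finset.univ.sup fun i => (b i - a i).natAbs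
  have hN : ∀ i, |b i - a i| ≤ (N : ℤ) := by
    intro i
    have h1 : (b i - a i).natAbs ≤ N := Finset.le_sup (f := fun i => (b i - a i).natAbs) (Finset.mem_univ i)
    have h2 : ((b i - a i).natAbs : ℤ) = |b i - a i| := Int.natCast_natAbs (b i - a i)
    rw [← h2]
    exact_mod_cast h1
  have h := key N
  rwa [approach_of_le a b hN] at h

/-! ## C. Components: closed sets, monotonicity -/

/-- A set containing `a` and closed under touching steps inside `R` contains the component of `a`. [folklore] -/
theorem tComp_subset_of_closed {R S : Set (Pt d)} {a : Pt d} (ha : a ∈ S)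
    (hcl : ∀ x ∈ S, ∀ y ∈ R, Touching x y → y ∈ S) : tComp R a ⊆ S := by
  intro b hb
  induction hb with
  | refl => exact ha
  | tail _ hstep ih => exact hcl _ ih _ hstep.2.1 hstep.2.2

/-- Chains survive enlarging the ambient set. [folklore] -/
theorem TConn.mono {R R' : Set (Pt d)} (h : R ⊆ R') {a b : Pt d} (hab : TConn R a b) : TConn R' a b := by
  induction hab with
  | refl => exact Relation.ReflTransGen.refl
  | tail _ hstep ih => exact Relation.ReflTransGen.tail ih ⟨h hstep.1, h hstep.2.1, hstep.2.2⟩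

/-! ## D. The replacement: single pass, the condition (2.3), fixpoints -/

/-- ONE SIMULTANEOUS PASS of the printed replacement on the set `Z` of cube indices: adjoin the bounding box of every
component that fits in an `N`-cube (p. 251 *"we replace such components by the smallest rectangular parallelepipeds
containing them"*, p. 269). [cite: Balaban1988Convergent, p.251, p.269] -/
def pass (N : ℕ) (Z : Set (Pt d)) : Set (Pt d) :=
  {c | c ∈ Z ∨ ∃ a ∈ Z, FitsIn N (tComp Z a) ∧ c ∈ bbox (tComp Z a)}

/-- The condition (2.3) with size parameter `N`: *"if a component of Z_j is contained in a cube of the size 100MR_j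
…, then it is a rectangular parallelepiped"*. [cite: Balaban1988Convergent, (2.3) p.255] -/
def Cond23 (N : ℕ) (Z : Set (Pt d)) : Prop := ∀ a ∈ Z, FitsIn N (tComp Z a) → IsBox (tComp Z a)

/-- The pass only adds cubes (the small field region `Λ` only shrinks). [folklore] -/
theorem subset_pass (N : ℕ) (Z : Set (Pt d)) : Z ⊆ pass N Z := fun _ hc => Or.inl hc

/-- Inside a box `A ⊇ Z` the pass stays inside `A`. [folklore] -/
theorem pass_subset_ibox (N : ℕ) {Z : Set (Pt d)} {lo hi : Pt d} (hZ : Z ⊆ ibox lo hi) :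
    pass N Z ⊆ ibox lo hi := by
  rintro c (hc | ⟨a, ha, _, hcb⟩)
  · exact hZ hc
  · exact bbox_subset_ibox ((tComp_subset ha).trans hZ) hcb

/-- [folklore] -/
theorem pass_inflationary (N : ℕ) (lo hi : Pt d) :
    ∀ Z : Set (Pt d), Z ⊆ ibox lo hi → Z ⊆ pass N Z ∧ pass N Z ⊆ ibox lo hi :=
  fun Z hZ => ⟨subset_pass N Z, pass_subset_ibox N hZ⟩

/-- If the bounding box of a (finite) component lies inside `Z`, the component IS its bounding box's worth of cubes:
the box is connected and contains the component. [folklore] -/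
theorem bbox_subset_tComp {Z : Set (Pt d)} {a : Pt d} (hK : bbox (tComp Z a) ⊆ Z)
    (hfin : (tComp Z a).Finite) : bbox (tComp Z a) ⊆ tComp Z a := by
  obtain ⟨lo, hi, hb⟩ := bbox_isBox hfin ⟨a, mem_tComp_self Z a⟩
  intro c hc
  have haB : a ∈ ibox lo hi := by rw [← hb]; exact subset_bbox _ (mem_tComp_self Z a)
  have hcB : c ∈ ibox lo hi := by rw [← hb]; exact hc
  have hBZ : ibox lo hi ⊆ Z := by rw [← hb]; exact hK
  exact TConn.mono hBZ (ibox_tconn haB hcB)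

/-- **At a fixpoint of the pass, (2.3) holds** — the referee's «(2.3) by construction» (G-adv5-9 REPAIR).
[cite: Balaban1988Convergent, (2.3) p.255] -/
theorem cond23_of_fixpoint {N : ℕ} {Z : Set (Pt d)} (hfix : pass N Z = Z) : Cond23 N Z := by
  intro a ha hfit
  have hfin : (tComp Z a).Finite := hfit.finite
  have hK : bbox (tComp Z a) ⊆ Z := by
    intro c hc
    have : c ∈ pass N Z := Or.inr ⟨a, ha, hfit, hc⟩
    rwa [hfix] at this
  have heq : bbox (tComp Z a) = tComp Z a :=
    Set.Subset.antisymm (bbox_subset_tComp hK hfin) (subset_bbox _)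
  obtain ⟨lo, hi, hb⟩ := bbox_isBox hfin ⟨a, mem_tComp_self Z a⟩
  exact ⟨lo, hi, by rw [← heq, hb]⟩

/-! ## E. Termination: an inflationary operation inside a finite set stabilises -/

/-- **Iteration to the fixpoint terminates.**  If `Z ⊆ Φ Z ⊆ A` for all `Z ⊆ A`, `A` finite, then after `#A`
steps the iterate is a fixpoint of `Φ` (the referee's «grows monotonically inside a finite lattice, so the
iteration terminates», G-adv5-9 REPAIR). [folklore] -/
theorem iterate_fix {α : Type*} (A : Set α) (hA : A.Finite) (Φ : Set α → Set α)
    (hΦ : ∀ Z : Set α, Z ⊆ A → Z ⊆ Φ Z ∧ Φ Z ⊆ A) (Z : Set α) (hZ : Z ⊆ A) :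
    Φ (Φ^[A.ncard] Z) = Φ^[A.ncard] Z := by
  have hsub : ∀ n, Φ^[n] Z ⊆ A := by
    intro n
    induction n with
    | zero => simpa using hZ
    | succ n ih => rw [Function.iterate_succ_apply']; exact (hΦ _ ih).2
  have hmono : ∀ n, Φ^[n] Z ⊆ Φ^[n + 1] Z := fun n => by
    rw [Function.iterate_succ_apply']; exact (hΦ _ (hsub n)).1
  have habs : ∀ n m, Φ^[n + 1] Z = Φ^[n] Z → Φ^[n + m] Z = Φ^[n] Z := by
    intro n m h
    induction m with
    | zero => rfl
    | succ m ih =>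
        calc Φ^[n + (m + 1)] Z = Φ (Φ^[n + m] Z) := by rw [← Nat.add_assoc, Function.iterate_succ_apply']
          _ = Φ (Φ^[n] Z) := by rw [ih]
          _ = Φ^[n + 1] Z := by rw [Function.iterate_succ_apply']
          _ = Φ^[n] Z := h
  by_contra hne
  have hstrict : ∀ n, n ≤ A.ncard → Φ^[n + 1] Z ≠ Φ^[n] Z := by
    intro n hn heq
    apply hne
    have e1 := habs n (A.ncard - n) heq
    have e2 := habs n (A.ncard - n + 1) heq
    rw [show n + (A.ncard - n) = A.ncard by omega] at e1
    rw [show n + (A.ncard - n + 1) = A.ncard + 1 by omega, Function.iterate_succ_apply'] at e2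
    rw [e2, e1]
  have hcard : ∀ n, n ≤ A.ncard + 1 → n ≤ (Φ^[n] Z).ncard := by
    intro n
    induction n with
    | zero => intro; exact Nat.zero_le _
    | succ n ih =>
        intro hn
        have hss : Φ^[n] Z ⊂ Φ^[n + 1] Z :=
          Set.ssubset_iff_subset_ne.mpr ⟨hmono n, (hstrict n (by omega)).symm⟩
        have hlt : (Φ^[n] Z).ncard < (Φ^[n + 1] Z).ncard := Set.ncard_lt_ncard hss (hA.subset (hsub (n + 1)))
        have := ih (by omega)
        omega
  have h1 := hcard (A.ncard + 1) le_rfl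
  have h2 : (Φ^[A.ncard + 1] Z).ncard ≤ A.ncard := Set.ncard_le_ncard (hsub _) hA
  omega

/-- **The repaired operation**: iterate the pass `#A` times inside any box `A ⊇ Z`; the result is a fixpoint …
[folklore] -/
theorem pass_iterate_fixpoint (N : ℕ) {lo hi : Pt d} {Z : Set (Pt d)} (hZ : Z ⊆ ibox lo hi) :
    pass N ((pass N)^[(ibox lo hi).ncard] Z) = (pass N)^[(ibox lo hi).ncard] Z :=
  iterate_fix (ibox lo hi) (ibox_finite lo hi) (pass N) (pass_inflationary N lo hi) Z hZ

/-- … containing `Z` and contained in `A` … [folklore] -/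
theorem subset_pass_iterate (N n : ℕ) {lo hi : Pt d} {Z : Set (Pt d)} (hZ : Z ⊆ ibox lo hi) :
    Z ⊆ (pass N)^[n] Z ∧ (pass N)^[n] Z ⊆ ibox lo hi := by
  induction n with
  | zero => exact ⟨subset_rfl, hZ⟩
  | succ n ih =>
      rw [Function.iterate_succ_apply']
      exact ⟨ih.1.trans (subset_pass N _), pass_subset_ibox N ih.2⟩

/-- … and satisfying (2.3): the referee's REPAIR of G-adv5-9 / G-adv5-11 (i) as a theorem.
[cite: Balaban1988Convergent, (2.3) p.255] -/
theorem cond23_iterate (N : ℕ) {lo hi : Pt d} {Z : Set (Pt d)} (hZ : Z ⊆ ibox lo hi) :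
    Cond23 N ((pass N)^[(ibox lo hi).ncard] Z) :=
  cond23_of_fixpoint (pass_iterate_fixpoint N hZ)

/-! ## F. A single pass does not give (2.3): the `d = 2` instance of the referee's example (G-adv5-9) -/

/-- Index-level one-layer touching-enlargement (the shape of `R₁′~`, p. 251). [folklore] -/
def ienl (R : Set (Pt d)) : Set (Pt d) := {c | ∃ r ∈ R, Touching c r}

/-- `K1`: the L-shaped region `[−1,1]×[−1,4] ∪ [−1,4]×[−1,1]`. [folklore] -/
def K1 : Set (Pt 2) :=
  {c | (-1 ≤ c 0 ∧ c 0 ≤ 1 ∧ -1 ≤ c 1 ∧ c 1 ≤ 4) ∨ (-1 ≤ c 0 ∧ c 0 ≤ 4 ∧ -1 ≤ c 1 ∧ c 1 ≤ 1)}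

/-- `K2`: the box `[5,7]²`. [folklore] -/
def K2 : Set (Pt 2) := {c | 5 ≤ c 0 ∧ c 0 ≤ 7 ∧ 5 ≤ c 1 ∧ c 1 ≤ 7}

/-- `Z0 = K1 ∪ K2`: the large field region before the replacement. [folklore] -/
def Z0 : Set (Pt 2) := K1 ∪ K2

/-- `B1 = [−1,4]²`: the bounding box of `K1`. [folklore] -/
def B1 : Set (Pt 2) := {c | -1 ≤ c 0 ∧ c 0 ≤ 4 ∧ -1 ≤ c 1 ∧ c 1 ≤ 4}

/-- `Z1 = [−1,4]² ∪ [5,7]²`: the region after ONE pass. [folklore] -/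
def Z1 : Set (Pt 2) := B1 ∪ K2

/-- `K1` is the one-layer enlargement of the cubes `(0,0)`, `(0,3)`, `(3,0)` (the shape of an `R₁′~`). [folklore] -/
theorem K1_eq_ienl : K1 = ienl ({![0, 0], ![0, 3], ![3, 0]} : Set (Pt 2)) := by
  ext c
  simp only [K1, ienl, Touching, Set.mem_setOf_eq, Set.mem_insert_iff, Set.mem_singleton_iff,
    exists_eq_or_imp, exists_eq_left, Fin.forall_fin_two, Matrix.cons_val_zero, Matrix.cons_val_one, abs_le]
  omega

/-- `K2` is the one-layer enlargement of the cube `(6,6)`. [folklore] -/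
theorem K2_eq_ienl : K2 = ienl ({![6, 6]} : Set (Pt 2)) := by
  ext c
  simp only [K2, ienl, Touching, Set.mem_setOf_eq, Set.mem_singleton_iff, exists_eq_left, Fin.forall_fin_two,
    Matrix.cons_val_zero, Matrix.cons_val_one, abs_le]
  omega

/-- Membership in a `d = 2` box, unfolded. [folklore] -/
theorem mem_ibox_two {lo hi c : Pt 2} : c ∈ ibox lo hi ↔ lo 0 ≤ c 0 ∧ c 0 ≤ hi 0 ∧ lo 1 ≤ c 1 ∧ c 1 ≤ hi 1 := by
  simp [ibox, Fin.forall_fin_two, and_assoc]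

/-- `K1` is closed under touching steps inside `Z0` (no cube of `K2` touches `K1`). [folklore] -/
theorem K1_closed : ∀ x ∈ K1, ∀ y ∈ Z0, Touching x y → y ∈ K1 := by
  intro x hx y hy hxy
  rcases hy with hy | hy
  · exact hy
  · exfalso
    have h0 := abs_le.mp (hxy 0)
    have h1 := abs_le.mp (hxy 1)
    simp only [K1, K2, Set.mem_setOf_eq] at hx hy
    omega

/-- `K2` is closed under touching steps inside `Z0`. [folklore] -/
theorem K2_closed : ∀ x ∈ K2, ∀ y ∈ Z0, Touching x y → y ∈ K2 := by
  intro x hx y hy hxy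
  rcases hy with hy | hy
  · exfalso
    have h0 := abs_le.mp (hxy 0)
    have h1 := abs_le.mp (hxy 1)
    simp only [K1, K2, Set.mem_setOf_eq] at hx hy
    omega
  · exact hy

/-- `K1` as the union of two boxes through the origin. [folklore] -/
theorem K1_eq_union : K1 = ibox ![-1, -1] ![1, 4] ∪ ibox ![-1, -1] ![4, 1] := by
  ext c
  simp only [K1, Set.mem_setOf_eq, Set.mem_union, mem_ibox_two, Matrix.cons_val_zero, Matrix.cons_val_one]

/-- `K2` is a box. [folklore] -/
theorem K2_eq_ibox : K2 = ibox ![5, 5] ![7, 7] := by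
  ext c
  simp only [K2, Set.mem_setOf_eq, mem_ibox_two, Matrix.cons_val_zero, Matrix.cons_val_one]

/-- `B1` is a box. [folklore] -/
theorem B1_eq_ibox : B1 = ibox ![-1, -1] ![4, 4] := by
  ext c
  simp only [B1, Set.mem_setOf_eq, mem_ibox_two, Matrix.cons_val_zero, Matrix.cons_val_one]

/-- `K1` is touching-connected (two boxes sharing the origin). [folklore] -/
theorem K1_tconn {a c : Pt 2} (ha : a ∈ K1) (hc : c ∈ K1) : TConn K1 a c := by
  have ho1 : (![0, 0] : Pt 2) ∈ ibox ![-1, -1] ![1, 4] := by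
    simp [mem_ibox_two]
  have ho2 : (![0, 0] : Pt 2) ∈ ibox ![-1, -1] ![4, 1] := by
    simp [mem_ibox_two]
  have hs1 : ibox ![-1, -1] ![1, 4] ⊆ K1 := by rw [K1_eq_union]; exact Set.subset_union_left
  have hs2 : ibox ![-1, -1] ![4, 1] ⊆ K1 := by rw [K1_eq_union]; exact Set.subset_union_right
  have h1 : TConn K1 a ![0, 0] := by
    rw [K1_eq_union] at ha
    rcases ha with ha | ha
    · exact TConn.mono hs1 (ibox_tconn ha ho1)
    · exact TConn.mono hs2 (ibox_tconn ha ho2)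
  have h2 : TConn K1 ![0, 0] c := by
    rw [K1_eq_union] at hc
    rcases hc with hc | hc
    · exact TConn.mono hs1 (ibox_tconn ho1 hc)
    · exact TConn.mono hs2 (ibox_tconn ho2 hc)
  exact h1.trans h2

/-- **The components of `Z0` are `K1` and `K2`.** [folklore] -/
theorem tComp_Z0_of_mem_K1 {a : Pt 2} (ha : a ∈ K1) : tComp Z0 a = K1 := by
  refine Set.Subset.antisymm (tComp_subset_of_closed ha K1_closed) ?_
  intro c hc
  exact TConn.mono (Set.subset_union_left : K1 ⊆ Z0) (K1_tconn ha hc)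

/-- [folklore] -/
theorem tComp_Z0_of_mem_K2 {a : Pt 2} (ha : a ∈ K2) : tComp Z0 a = K2 := by
  refine Set.Subset.antisymm (tComp_subset_of_closed ha K2_closed) ?_
  intro c hc
  rw [K2_eq_ibox] at ha hc
  have h := ibox_tconn ha hc
  rw [← K2_eq_ibox] at h
  exact TConn.mono (Set.subset_union_right : K2 ⊆ Z0) h

/-- Both components are small: `K1` fits in a `6`-cube, … [folklore] -/
theorem K1_fitsIn : FitsIn 6 K1 := by
  refine ⟨![-1, -1], fun c hc => ?_⟩
  rw [mem_ibox_two]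
  simp only [K1, Set.mem_setOf_eq] at hc
  simp only [Matrix.cons_val_zero, Matrix.cons_val_one]
  omega

/-- … `K2` in a `3`-cube. [folklore] -/
theorem K2_fitsIn : FitsIn 3 K2 := by
  refine ⟨![5, 5], fun c hc => ?_⟩
  rw [mem_ibox_two]
  simp only [K2, Set.mem_setOf_eq] at hc
  simp only [Matrix.cons_val_zero, Matrix.cons_val_one]
  omega

/-- The bounding box of `K1` is `B1 = [−1,4]²`. [folklore] -/
theorem bbox_K1 : bbox K1 = B1 := by
  apply Set.Subset.antisymm
  · have h : K1 ⊆ ibox ![-1, -1] ![4, 4] := by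
      intro c hc
      rw [mem_ibox_two]
      simp only [K1, Set.mem_setOf_eq] at hc
      simp only [Matrix.cons_val_zero, Matrix.cons_val_one]
      omega
    rw [B1_eq_ibox]
    exact bbox_subset_ibox h
  · intro c hc
    simp only [B1, Set.mem_setOf_eq] at hc
    have m1 : (![-1, -1] : Pt 2) ∈ K1 := by simp [K1]
    have m2 : (![4, 0] : Pt 2) ∈ K1 := by simp [K1]
    have m3 : (![0, 4] : Pt 2) ∈ K1 := by simp [K1]
    rw [bbox, Set.mem_setOf_eq, Fin.forall_fin_two]
    refine ⟨⟨⟨![-1, -1], m1, ?_⟩, ⟨![4, 0], m2, ?_⟩⟩, ⟨⟨![-1, -1], m1, ?_⟩, ⟨![0, 4], m3, ?_⟩⟩⟩ <;>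
      simp <;> omega

/-- The bounding box of the box `K2` is `K2`. [folklore] -/
theorem bbox_K2 : bbox K2 = K2 := by
  rw [K2_eq_ibox, bbox_ibox]

/-- **The single pass on `Z0` yields `Z1 = [−1,4]² ∪ [5,7]²** (any size threshold `N ≥ 6`).
[cite: Balaban1988Convergent, p.251] -/
theorem pass_Z0 {N : ℕ} (hN : 6 ≤ N) : pass N Z0 = Z1 := by
  ext c
  constructor
  · rintro (hc | ⟨a, ha, _, hcb⟩)
    · rcases hc with hc | hc
      · left
        have := subset_bbox K1 hc
        rwa [bbox_K1] at this
      · exact Or.inr hc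
    · rcases ha with ha | ha
      · rw [tComp_Z0_of_mem_K1 ha, bbox_K1] at hcb
        exact Or.inl hcb
      · rw [tComp_Z0_of_mem_K2 ha, bbox_K2] at hcb
        exact Or.inr hcb
  · rintro (hc | hc)
    · have m0 : (![0, 0] : Pt 2) ∈ K1 := by simp [K1]
      refine Or.inr ⟨![0, 0], Or.inl m0, ?_, ?_⟩
      · rw [tComp_Z0_of_mem_K1 m0]
        exact K1_fitsIn.mono hN
      · rw [tComp_Z0_of_mem_K1 m0, bbox_K1]
        exact hc
    · exact Or.inl (Or.inr hc)

/-- After the pass the two boxes touch at the corner `(4,4)–(5,5)`: **`Z1` is ONE touching-component**. [folklore] -/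
theorem tComp_Z1 : tComp Z1 ![0, 0] = Z1 := by
  have m0 : (![0, 0] : Pt 2) ∈ B1 := by simp [B1]
  refine Set.Subset.antisymm (tComp_subset (Or.inl m0)) ?_
  have hB1 : B1 ⊆ Z1 := Set.subset_union_left
  have hK2 : K2 ⊆ Z1 := Set.subset_union_right
  have m44 : (![4, 4] : Pt 2) ∈ B1 := by simp [B1]
  have m55 : (![5, 5] : Pt 2) ∈ K2 := by simp [K2]
  have hcorner : Touching (![4, 4] : Pt 2) ![5, 5] := by
    rw [Touching, Fin.forall_fin_two]
    simp
  have h04 : TConn Z1 ![0, 0] ![4, 4] := by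
    rw [B1_eq_ibox] at m0 m44
    have h := ibox_tconn m0 m44
    rw [← B1_eq_ibox] at h
    exact TConn.mono hB1 h
  have h05 : TConn Z1 ![0, 0] ![5, 5] := Relation.ReflTransGen.tail h04 ⟨hB1 m44, hK2 m55, hcorner⟩
  intro c hc
  rcases hc with hc | hc
  · rw [B1_eq_ibox] at m0 hc
    have h := ibox_tconn m0 hc
    rw [← B1_eq_ibox] at h
    exact TConn.mono hB1 h
  · rw [K2_eq_ibox] at m55 hc
    have h := ibox_tconn m55 hc
    rw [← K2_eq_ibox] at h
    exact h05.trans (TConn.mono hK2 h)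

/-- `Z1` fits in a `9`-cube (`[−1,7]²`) — far below the printed threshold `100`. [folklore] -/
theorem Z1_fitsIn : FitsIn 9 Z1 := by
  refine ⟨![-1, -1], fun c hc => ?_⟩
  rw [mem_ibox_two]
  rcases hc with hc | hc <;> simp only [B1, K2, Set.mem_setOf_eq] at hc <;>
    simp only [Matrix.cons_val_zero, Matrix.cons_val_one] <;> omega

/-- **`Z1` is not a rectangular parallelepiped** (it contains `(−1,−1)` and `(7,7)` but not `(−1,7)`). [folklore] -/
theorem Z1_not_box : ¬ IsBox Z1 := by
  rintro ⟨lo, hi, h⟩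
  have m1 : (![-1, -1] : Pt 2) ∈ Z1 := Or.inl (by simp [B1])
  have m2 : (![7, 7] : Pt 2) ∈ Z1 := Or.inr (by simp [K2])
  have m3 : (![-1, 7] : Pt 2) ∉ Z1 := by
    rintro (h3 | h3)
    · simp [B1] at h3
    · simp [K2] at h3
  rw [h, mem_ibox_two] at m1 m2 m3
  simp only [Matrix.cons_val_zero, Matrix.cons_val_one] at m1 m2 m3
  omega

/-- **A single pass does not produce (2.3)**: for every threshold `N ≥ 9` (printed: `100`) the region `pass N Z0`
has a component — all of it — contained in an `N`-cube and not a rectangular parallelepiped.  The kernel form of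
cell GAPS.md G-adv5-9 / G-adv5-11 (i) (touching reading; `d = 2` slice of the referee's `ℤ⁴` example).
[cite: Balaban1988Convergent, p.251, (2.3) p.255, p.269] -/
theorem single_pass_fails {N : ℕ} (hN : 9 ≤ N) : ¬ Cond23 N (pass N Z0) := by
  intro h
  rw [pass_Z0 (by omega)] at h
  have m0 : (![0, 0] : Pt 2) ∈ Z1 := Or.inl (by simp [B1])
  have hbox := h ![0, 0] m0 (by rw [tComp_Z1]; exact Z1_fitsIn.mono hN)
  rw [tComp_Z1] at hbox
  exact Z1_not_box hbox

/-- Whereas one more pass repairs this instance: `Z1`'s only small component is all of `Z1`, whose bounding box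
`[−1,7]²` is then adjoined; in general `cond23_iterate` applies. [folklore] -/
theorem pass_Z1_eq_bbox {N : ℕ} (hN : 9 ≤ N) : pass N Z1 = bbox Z1 := by
  ext c
  constructor
  · rintro (hc | ⟨a, ha, _, hcb⟩)
    · exact subset_bbox Z1 hc
    · have hcomp : tComp Z1 a = Z1 := by
        have ha' : a ∈ tComp Z1 ![0, 0] := by rw [tComp_Z1]; exact ha
        apply Set.Subset.antisymm (tComp_subset ha)
        intro x hx
        have hx' : x ∈ tComp Z1 ![0, 0] := by rw [tComp_Z1]; exact hx
        exact (TConn.symm ha').trans hx'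
      rwa [hcomp] at hcb
  · intro hc
    have m0 : (![0, 0] : Pt 2) ∈ Z1 := Or.inl (by simp [B1])
    refine Or.inr ⟨![0, 0], m0, ?_, ?_⟩
    · rw [tComp_Z1]; exact Z1_fitsIn.mono hN
    · rw [tComp_Z1]; exact hc

end Literature.MathematicalPhysics.QuantumFieldTheory.Balaban1983to89.B14BoxFix
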